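import Literature.NumberTheory.GaloisRepresentations.CrystallineOrdinaryShape
import Literature.NumberTheory.GaloisRepresentations.LocalGaloisGroup
import HarnessLib
import Mathlib.LinearAlgebra.FiniteDimensional.Lemmas
import Mathlib.LinearAlgebra.Matrix.ToLin

/-!
# The Greenberg plane of a shape-`(0,0,1,1)` Greenberg-ordinary `ρ : Γ_K → GL₄(ℚ̄_p)` (stub `stub_greenbergPlane`, N1a) — line `sector-klingen-split`

Stub-worker of lead prover-line-stmt-Langlands-13639-c4-0 (crux `ResiduallyYoshidaLifting`, stmt-Langlands-13639,
skeleton rev 8, sub-goal N1a of "the Greenberg (Selmer) condition AT `p` of the cocycle realised by an `Sh`-point").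

**Theorem (`stub_greenbergPlane`).**  Let `K` be a non-archimedean local field, `ρ : Γ_K → GL₄(ℚ̄_p)` a framed
representation which is Greenberg-ordinary of inertial shape `(0,0,1,1)` (`FramedRep.IsGreenbergOrdinaryOfShape`): there
is a frame `g` with every `M(τ) = g ρ(τ) g⁻¹` upper triangular, inertial diagonal `(1, 1, ε⁻¹, ε⁻¹)` and `M(τ)₀₁ = 0 = M(τ)₂₃`
for `τ ∈ I_K`.  Then `ρ` has a `Γ_K`-stable PLANE `U ⊆ ℚ̄_p⁴` on which INERTIA ACTS TRIVIALLY.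

**Proof.**  `U := g⁻¹⟨e₀, e₁⟩ = ker (u ↦ ((g u)₂, (g u)₃))`.  The map is surjective (`g` is invertible), so
`dim U = 4 - 2 = 2`.  Writing `g (ρ τ u) = M(τ) (g u)`, stability is the vanishing of the entries `M(τ)ᵢⱼ`, `i ∈ {2,3}`,
`j ∈ {0,1}` (and `M₃₂`), and for `τ ∈ I_K` the top-left `2 × 2` block of `M(τ)` is the identity, so `g (ρ τ u) = g u`.

Also recorded (abstract linear algebra, for the N1 assembly): if `U` is a plane fixed pointwise by a family `f`, and `X`
an `f`-stable plane moved by some `f i` with `V/X` moved too (`dim V = 4`), then `U ∩ X` is a LINE and `U + X` is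
`3`-dimensional (`finrank_inf_eq_one_of_fixedPlane`, `finrank_sup_eq_three_of_fixedPlane`), with the companion facts
`sub_mem_of_mem_sup_fixedPlane`, `inf_fixed_and_stable`, and the typed corollary `greenbergPlane_inf_line`.

-- re-derived from Cruxes/ResiduallyYoshidaLifting/Disproof.lean T13 (exists_greenbergPlane), refuter cdisprove gen 5
-/

noncomputable section

open scoped Matrix

set_option linter.dupNamespace false
set_option autoImplicit false

namespace Summit.Langlands.Langlands.Cruxes.ResiduallyYoshidaLifting.SectorKlingenSplit.Fibre

open Literature.NumberTheory.GaloisRepresentations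
open Module Submodule Matrix

/-! ### T13 abstract core: a pointwise-fixed plane meets a moved stable plane in a line -/

section GreenbergPlaneAbstract

variable {k V : Type*} [Field k] [AddCommGroup V] [Module k V]

/-- **T13 (abstract core).**  `V` 4-dimensional; `U` a plane fixed pointwise by every `f i`; `X` an `f`-stable plane on
which some `f i` acts non-trivially and such that some `f i` acts non-trivially on `V/X`.  Then `U ∩ X` is a LINE
(neither `0` — else `V = U ⊕ X` and `V/X ≅ U` would be `f`-trivial — nor `U` — else `X = U` would be `f`-trivial).
[folklore] -/
theorem finrank_inf_eq_one_of_fixedPlane [FiniteDimensional k V] {ι : Type*} (f : ι → V →ₗ[k] V)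
    (h4 : finrank k V = 4) (U X : Submodule k V)
    (hU : finrank k U = 2) (hX : finrank k X = 2)
    (hUfix : ∀ i, ∀ u ∈ U, f i u = u)
    (hXinv : ∀ i, ∀ x ∈ X, f i x ∈ X)
    (hXmoves : ∃ i, ∃ x ∈ X, f i x ≠ x)
    (hQmoves : ∃ i v, f i v - v ∉ X) :
    finrank k ↥(U ⊓ X) = 1 := by
  -- re-derived from Cruxes/ResiduallyYoshidaLifting/Disproof.lean T13 (finrank_inf_eq_one_of_fixedPlane), refuter cdisprove gen 5
  have hle2 : finrank k ↥(U ⊓ X) ≤ 2 := hU ▸ Submodule.finrank_mono inf_le_left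
  have hne2 : finrank k ↥(U ⊓ X) ≠ 2 := by
    intro h2
    have hUX : U ⊓ X = U := eq_of_le_of_finrank_eq inf_le_left (h2.trans hU.symm)
    have hUleX : U ≤ X := by rw [← hUX]; exact inf_le_right
    have hUeqX : U = X := eq_of_le_of_finrank_eq hUleX (hU.trans hX.symm)
    obtain ⟨i, x, hx, hne⟩ := hXmoves
    exact hne (hUfix i x (by rw [hUeqX]; exact hx))
  have hne0 : finrank k ↥(U ⊓ X) ≠ 0 := by
    intro h0
    have hsup : finrank k ↥(U ⊔ X) = 4 := by
      have := Submodule.finrank_sup_add_finrank_inf_eq U X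
      omega
    have htop : U ⊔ X = ⊤ := eq_top_of_finrank_eq (hsup.trans h4.symm)
    obtain ⟨i, v, hv⟩ := hQmoves
    have hvmem : v ∈ U ⊔ X := htop ▸ mem_top
    obtain ⟨u, hu, x, hx, rfl⟩ := mem_sup.1 hvmem
    apply hv
    have : f i (u + x) - (u + x) = f i x - x := by
      rw [map_add, hUfix i u hu]; abel
    rw [this]
    exact X.sub_mem (hXinv i x hx) hx
  omega

/-- … so `U + X` is `3`-dimensional: the image of `U` in `V/X` is a LINE. [folklore] -/
theorem finrank_sup_eq_three_of_fixedPlane [FiniteDimensional k V] {ι : Type*} (f : ι → V →ₗ[k] V)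
    (h4 : finrank k V = 4) (U X : Submodule k V)
    (hU : finrank k U = 2) (hX : finrank k X = 2)
    (hUfix : ∀ i, ∀ u ∈ U, f i u = u)
    (hXinv : ∀ i, ∀ x ∈ X, f i x ∈ X)
    (hXmoves : ∃ i, ∃ x ∈ X, f i x ≠ x)
    (hQmoves : ∃ i v, f i v - v ∉ X) :
    finrank k ↥(U ⊔ X) = 3 := by
  -- re-derived from Cruxes/ResiduallyYoshidaLifting/Disproof.lean T13 (finrank_sup_eq_three_of_fixedPlane)
  have h1 := finrank_inf_eq_one_of_fixedPlane f h4 U X hU hX hUfix hXinv hXmoves hQmoves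
  have := Submodule.finrank_sup_add_finrank_inf_eq U X
  omega

/-- … on which every `f i` acts trivially modulo `X`. [folklore] -/
theorem sub_mem_of_mem_sup_fixedPlane {ι : Type*} (f : ι → V →ₗ[k] V) (U X : Submodule k V)
    (hUfix : ∀ i, ∀ u ∈ U, f i u = u) (hXinv : ∀ i, ∀ x ∈ X, f i x ∈ X)
    (i : ι) {v : V} (hv : v ∈ U ⊔ X) : f i v - v ∈ X := by
  -- re-derived from Cruxes/ResiduallyYoshidaLifting/Disproof.lean T13 (sub_mem_of_mem_sup_fixedPlane)
  obtain ⟨u, hu, x, hx, rfl⟩ := mem_sup.1 hv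
  have : f i (u + x) - (u + x) = f i x - x := by
    rw [map_add, hUfix i u hu]; abel
  rw [this]
  exact X.sub_mem (hXinv i x hx) hx

/-- … while the line `U ∩ X ⊆ X` is fixed by every `f i` and stable under every map stabilising `U` and `X`
(e.g. all of `ρ̄(G_{ℚ_p})`). [folklore] -/
theorem inf_fixed_and_stable {ι : Type*} (f : ι → V →ₗ[k] V) (U X : Submodule k V)
    (hUfix : ∀ i, ∀ u ∈ U, f i u = u) :
    (∀ i, ∀ v ∈ U ⊓ X, f i v = v) ∧
      ∀ T : V →ₗ[k] V, (∀ u ∈ U, T u ∈ U) → (∀ x ∈ X, T x ∈ X) → ∀ v ∈ U ⊓ X, T v ∈ U ⊓ X :=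
  -- re-derived from Cruxes/ResiduallyYoshidaLifting/Disproof.lean T13 (inf_fixed_and_stable)
  ⟨fun i v hv => hUfix i v hv.1, fun _ hTU hTX v hv => ⟨hTU v hv.1, hTX v hv.2⟩⟩

end GreenbergPlaneAbstract

/-! ### T13 typed: the Greenberg plane of `IsGreenbergOrdinaryOfShape (0,0,1,1)` as a submodule -/

/-- **Registered statement `stub_greenbergPlane`** (N1a; THE GREENBERG PLANE).  A shape-`(0,0,1,1)` Greenberg-ordinary
`ρ : Γ_K → GL₄(ℚ̄_p)` has a `Γ_K`-stable PLANE on which inertia acts TRIVIALLY (`U = g⁻¹⟨e₀, e₁⟩ = ker (rows 2, 3 of g)`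
for the Greenberg frame `g`). [folklore] -/
theorem stub_greenbergPlane :
    ∀ (K : Type) [Field K] [ValuativeRel K] [TopologicalSpace K] [IsNonarchimedeanLocalField K]
      (p : ℕ) [Fact p.Prime] (ρ : FramedRep (Field.absoluteGaloisGroup K) (PadicAlgCl p) 4),
      ρ.IsGreenbergOrdinaryOfShape ![0, 0, 1, 1] →
      ∃ U : Submodule (PadicAlgCl p) (Fin 4 → PadicAlgCl p), Module.finrank (PadicAlgCl p) U = 2 ∧
        (∀ τ, ∀ u ∈ U, (ρ τ).val *ᵥ u ∈ U) ∧
        (∀ τ ∈ absInertia K, ∀ u ∈ U, (ρ τ).val *ᵥ u = u) := by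
  -- re-derived from Cruxes/ResiduallyYoshidaLifting/Disproof.lean T13 (exists_greenbergPlane), refuter cdisprove gen 5
  intro K _ _ _ _ p _ ρ h
  obtain ⟨g, hup, hdiag, hoff⟩ := h
  set L : (Fin 4 → PadicAlgCl p) →ₗ[PadicAlgCl p] (Fin 2 → PadicAlgCl p) :=
    (LinearMap.funLeft (PadicAlgCl p) (PadicAlgCl p) (Fin.natAdd 2 : Fin 2 → Fin 4)) ∘ₗ
      Matrix.mulVecLin (g.val) with hL
  have hLapp : ∀ u i, L u i = (g.val *ᵥ u) (Fin.natAdd 2 i) := fun u i => rfl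
  have hmem : ∀ u, u ∈ LinearMap.ker L ↔ (g.val *ᵥ u) 2 = 0 ∧ (g.val *ᵥ u) 3 = 0 := by
    intro u
    rw [LinearMap.mem_ker]
    constructor
    · intro h0
      exact ⟨by simpa [hLapp] using congrFun h0 0, by simpa [hLapp] using congrFun h0 1⟩
    · rintro ⟨h2, h3⟩
      funext i
      fin_cases i
      · simpa [hLapp] using h2
      · simpa [hLapp] using h3
  -- `g *ᵥ (g⁻¹ *ᵥ x) = x` and `g⁻¹ *ᵥ (g *ᵥ x) = x`
  have hgg : ∀ x, g.val *ᵥ ((g⁻¹).val *ᵥ x) = x := fun x => by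
    rw [mulVec_mulVec, ← Units.val_mul, mul_inv_cancel, Units.val_one, one_mulVec]
  have hgg' : ∀ x, (g⁻¹).val *ᵥ (g.val *ᵥ x) = x := fun x => by
    rw [mulVec_mulVec, ← Units.val_mul, inv_mul_cancel, Units.val_one, one_mulVec]
  have hsurj : Function.Surjective L := by
    intro z
    refine ⟨(g⁻¹).val *ᵥ ![0, 0, z 0, z 1], ?_⟩
    funext i
    rw [hLapp, hgg]
    fin_cases i <;> rfl
  -- conjugation bookkeeping: `M(τ) g = g ρ(τ)` for `M(τ) = g ρ(τ) g⁻¹`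
  have hMg : ∀ τ, ((g * ρ τ * g⁻¹ : GL (Fin 4) (PadicAlgCl p)) : Matrix (Fin 4) (Fin 4) (PadicAlgCl p)) *
      g.val = g.val * (ρ τ).val := fun τ => by
    rw [← Units.val_mul, inv_mul_cancel_right, Units.val_mul]
  have hgx : ∀ τ u, g.val *ᵥ ((ρ τ).val *ᵥ u) =
      ((g * ρ τ * g⁻¹ : GL (Fin 4) (PadicAlgCl p)) : Matrix (Fin 4) (Fin 4) (PadicAlgCl p)) *ᵥ
        (g.val *ᵥ u) := fun τ u => by
    rw [mulVec_mulVec, ← hMg, ← mulVec_mulVec]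
  refine ⟨LinearMap.ker L, ?_, ?_, ?_⟩
  · have h := LinearMap.finrank_range_add_finrank_ker L
    rw [LinearMap.range_eq_top.2 hsurj, finrank_top] at h
    simp only [Module.finrank_fin_fun] at h
    omega
  · intro τ u hu
    rw [hmem] at hu ⊢
    rw [hgx]
    set M : Matrix (Fin 4) (Fin 4) (PadicAlgCl p) :=
      ((g * ρ τ * g⁻¹ : GL (Fin 4) (PadicAlgCl p)) : Matrix (Fin 4) (Fin 4) (PadicAlgCl p)) with hM
    have h20 : M 2 0 = 0 := hup τ 2 0 (by decide)
    have h21 : M 2 1 = 0 := hup τ 2 1 (by decide)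
    have h30 : M 3 0 = 0 := hup τ 3 0 (by decide)
    have h31 : M 3 1 = 0 := hup τ 3 1 (by decide)
    have h32 : M 3 2 = 0 := hup τ 3 2 (by decide)
    generalize g.val *ᵥ u = x at hu ⊢
    constructor
    · simp [Matrix.mulVec, dotProduct, Fin.sum_univ_four, h20, h21, hu.1, hu.2]
    · simp [Matrix.mulVec, dotProduct, Fin.sum_univ_four, h30, h31, h32, hu.1, hu.2]
  · intro τ hτ u hu
    rw [hmem] at hu
    suffices hs : g.val *ᵥ ((ρ τ).val *ᵥ u) = g.val *ᵥ u by
      have := congrArg (fun x => (g⁻¹).val *ᵥ x) hs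
      simpa only [hgg'] using this
    rw [hgx]
    set M : Matrix (Fin 4) (Fin 4) (PadicAlgCl p) :=
      ((g * ρ τ * g⁻¹ : GL (Fin 4) (PadicAlgCl p)) : Matrix (Fin 4) (Fin 4) (PadicAlgCl p)) with hM
    have h00 : M 0 0 = 1 := by
      rw [hM, hdiag τ hτ 0]; simp
    have h11 : M 1 1 = 1 := by
      rw [hM, hdiag τ hτ 1]; simp
    have h01 : M 0 1 = 0 := hoff τ hτ 0 1 (by decide) (by simp)
    have h10 : M 1 0 = 0 := hup τ 1 0 (by decide)
    have h20 : M 2 0 = 0 := hup τ 2 0 (by decide)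
    have h21 : M 2 1 = 0 := hup τ 2 1 (by decide)
    have h30 : M 3 0 = 0 := hup τ 3 0 (by decide)
    have h31 : M 3 1 = 0 := hup τ 3 1 (by decide)
    have h32 : M 3 2 = 0 := hup τ 3 2 (by decide)
    generalize g.val *ᵥ u = x at hu ⊢
    funext i
    fin_cases i <;>
      simp [Matrix.mulVec, dotProduct, Fin.sum_univ_four, h00, h11, h01, h10, h20, h21, h30, h31,
        h32, hu.1, hu.2]

/-- **T13 typed.**  For a shape-`(0,0,1,1)` Greenberg-ordinary `ρ : Γ_K → GL₄(ℚ̄_p)` and a `ρ`-stable plane `X` moved by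
inertia with moved quotient, the Greenberg plane `U` meets `X` in a LINE (so `X` has a `Γ_K`-stable inertia-trivial line
`U ∩ X`, and `(U + X)/X` is another one in `ℚ̄_p⁴/X`). [folklore] -/
theorem greenbergPlane_inf_line
    {K : Type} [Field K] [ValuativeRel K] [TopologicalSpace K] [IsNonarchimedeanLocalField K]
    {p : ℕ} [Fact p.Prime] (ρ : FramedRep (Field.absoluteGaloisGroup K) (PadicAlgCl p) 4)
    (h : ρ.IsGreenbergOrdinaryOfShape ![0, 0, 1, 1])
    (X : Submodule (PadicAlgCl p) (Fin 4 → PadicAlgCl p)) (hX : finrank (PadicAlgCl p) X = 2)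
    (hXinv : ∀ τ, ∀ x ∈ X, (ρ τ).val *ᵥ x ∈ X)
    (hXmoves : ∃ τ ∈ absInertia K, ∃ x ∈ X, (ρ τ).val *ᵥ x ≠ x)
    (hQmoves : ∃ τ ∈ absInertia K, ∃ v, (ρ τ).val *ᵥ v - v ∉ X) :
    ∃ U : Submodule (PadicAlgCl p) (Fin 4 → PadicAlgCl p), finrank (PadicAlgCl p) U = 2 ∧
      (∀ τ, ∀ u ∈ U, (ρ τ).val *ᵥ u ∈ U) ∧
      (∀ τ ∈ absInertia K, ∀ u ∈ U, (ρ τ).val *ᵥ u = u) ∧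
      finrank (PadicAlgCl p) ↥(U ⊓ X) = 1 ∧ finrank (PadicAlgCl p) ↥(U ⊔ X) = 3 := by
  -- re-derived from Cruxes/ResiduallyYoshidaLifting/Disproof.lean T13 (greenbergPlane_inf_line), refuter cdisprove gen 5
  obtain ⟨U, hU, hstab, hfix⟩ := stub_greenbergPlane K p ρ h
  refine ⟨U, hU, hstab, hfix, ?_⟩
  let f : absInertia K → (Fin 4 → PadicAlgCl p) →ₗ[PadicAlgCl p] (Fin 4 → PadicAlgCl p) :=
    fun τ => Matrix.mulVecLin (ρ τ.1).val
  have hf : ∀ τ v, f τ v = (ρ τ.1).val *ᵥ v := fun τ v => rfl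
  have h4 : finrank (PadicAlgCl p) (Fin 4 → PadicAlgCl p) = 4 := by simp
  have h1 : finrank (PadicAlgCl p) ↥(U ⊓ X) = 1 := by
    refine finrank_inf_eq_one_of_fixedPlane f h4 U X hU hX ?_ ?_ ?_ ?_
    · intro τ u hu; rw [hf]; exact hfix τ.1 τ.2 u hu
    · intro τ x hx; rw [hf]; exact hXinv τ.1 x hx
    · obtain ⟨τ, hτ, x, hx, hne⟩ := hXmoves
      exact ⟨⟨τ, hτ⟩, x, hx, by rw [hf]; exact hne⟩
    · obtain ⟨τ, hτ, v, hv⟩ := hQmoves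
      exact ⟨⟨τ, hτ⟩, v, by rw [hf]; exact hv⟩
  refine ⟨h1, ?_⟩
  have := Submodule.finrank_sup_add_finrank_inf_eq U X
  omega

end Summit.Langlands.Langlands.Cruxes.ResiduallyYoshidaLifting.SectorKlingenSplit.Fibre

end
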